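import Summits.MatrixMultiplication.OmegaCensus.STPP222SqSeeds
import Summits.MatrixMultiplication.OmegaCensus.STPP222CubeFrom46
import Summits.MatrixMultiplication.OmegaCensus.STPP222PowCyclic

/-!
# ω-census, STPP law `(2,2,2)²`: every finite abelian group of order `≥ 24` other than `ℤ/5 × ℤ/5` admits it

HONEST FRAMING (pub-omega census; verbatim): lottery ticket; floor = certified bounds/negative ranges.
Census STRUCTURE bookkeeping (question Q7, the threshold function `N_k` / `n_k` of the pattern `(2,2,2)^k` in
finite abelian groups; row `k = 2`), not progress on `ω`: a `(2,2,2)²` STPP family (two simultaneous `⟨2,2,2⟩`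
triples, CKSU 2005 Def. 5.1, tree form `IsSTPP`) yields no matrix-multiplication bound of interest.

Main results:
* `exists_isSTPP_222sq_of_card_ne` — **every finite abelian group `G` with `24 ≤ |G|` and `|G| ≠ 25` has
  `A B C : Fin 2 → Finset G`, all of cardinality `2`, with `IsSTPP A B C`;**
* `exists_isSTPP_222sq_zmod25` — so does `ℤ/25` (the cyclic family of `STPP222PowCyclic.lean` at `k = 2`);
* `exists_isSTPP_222sq_of_card` / `stpp222SqFrom26` — hence every finite abelian group of order `≥ 26`.

So `N₂ ≤ 26` and `n₂ ≤ 24` in the kernel.  On the census side (complete searches by ENG2's m2 engine, 2026-08-23;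
engine results, NOT kernel theorems and not used here) the statement is sharp: every abelian group of order `≤ 23`
and `ℤ/5 × ℤ/5` lack `(2,2,2)²`, so `n₂ = 24`, `N₂ = 26`, and the cyclic onset `24` equals the uniform bound
`8k² − 8k + 8` of `STPP222PowCyclic.lean` at `k = 2`.

Proof — the reduction of `STPP222CubeFrom46.lean` with the constants changed:
1. exponent `≥ 24`: `exists_isSTPP_222pow_of_exponent 2` (`8·2·1 + 8 = 24`);
2. exponent `E ≤ 23`: structure theorem `AddCommGroup.equiv_directSum_zmod_of_finite`; the multiset `M` of nontrivial
   prime-power factors consists of prime powers `≤ 23` dividing `E`, with product `|G| ≥ 24`, `≠ 25`;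
3. COMBINATORIAL CORE (kernel `decide`, `dom_of_capped24`): every such multiset — after capping multiplicities
   (`cap26`, chosen with `v ^ cap26 v ≥ 26` so that capping cannot create the excluded product `25`) — dominates one of
   the 28 seeds of `STPP222SqSeeds.lean`;
4. generic embedding `exists_emb_of_dom` + transport `IsSTPP.image` (both from `STPP222CubeFrom46.lean`).

References: H. Cohn, R. Kleinberg, B. Szegedy, C. Umans, FOCS 2005 (arXiv:math/0511460), Def. 5.1.
Record: pub-omega HOME `pub-omega-eng2/results/c4red/K2-THRESHOLD-eng2.md` (ENG2 gen 16, 2026-08-23).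
-/

open Literature.Computability.AlgebraicComplexity Finset

namespace Summit.MatrixMultiplication.OmegaCensus

/-! ## 1. Seeds and the combinatorial core -/

/-- A `(2,2,2)²` seed: a list of moduli with a kernel proof that the product group `ℤ/s₁ × ⋯ × ℤ/s_k`
(`SeedType s`) admits two simultaneous-TPP triples of 2-subsets. [cite: CohnKleinbergSzegedyUmans2005, Def. 5.1] -/
structure Seed2 where
  /-- the moduli `s₁, …, s_k` (prime powers), in the order of the seed theorem's product type -/
  s : List ℕ
  /-- the product group admits the STPP pattern `(2,2,2)²` -/
  ok : ∃ A B C : Fin 2 → Finset (SeedType s), IsSTPP A B C ∧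
    ∀ i, (A i).card = 2 ∧ (B i).card = 2 ∧ (C i).card = 2

/-- The 28 seeds of `STPP222SqSeeds.lean`: the abelian groups of exponent `≤ 23`, order `≥ 24`, order `≠ 25` that are
minimal under domination (18 of order `24`–`45`, and 10 `(2,2,2)³` seeds restricted). -/
def seeds2 : List Seed2 := [
  ⟨[2, 2, 2, 3], exists_isSTPP_222sq_seed_2_2_2_3⟩, ⟨[2, 3, 4], exists_isSTPP_222sq_seed_2_3_4⟩,
  ⟨[3, 3, 3], exists_isSTPP_222sq_seed_3_3_3⟩, ⟨[3, 9], exists_isSTPP_222sq_seed_3_9⟩,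
  ⟨[2, 2, 7], exists_isSTPP_222sq_seed_2_2_7⟩, ⟨[2, 2, 2, 2, 2], exists_isSTPP_222sq_seed_2_2_2_2_2⟩,
  ⟨[2, 2, 2, 4], exists_isSTPP_222sq_seed_2_2_2_4⟩, ⟨[2, 2, 8], exists_isSTPP_222sq_seed_2_2_8⟩,
  ⟨[2, 4, 4], exists_isSTPP_222sq_seed_2_4_4⟩, ⟨[2, 16], exists_isSTPP_222sq_seed_2_16⟩,
  ⟨[4, 8], exists_isSTPP_222sq_seed_4_8⟩, ⟨[2, 2, 3, 3], exists_isSTPP_222sq_seed_2_2_3_3⟩,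
  ⟨[2, 2, 9], exists_isSTPP_222sq_seed_2_2_9⟩, ⟨[3, 3, 4], exists_isSTPP_222sq_seed_3_3_4⟩,
  ⟨[2, 2, 2, 5], exists_isSTPP_222sq_seed_2_2_2_5⟩, ⟨[2, 4, 5], exists_isSTPP_222sq_seed_2_4_5⟩,
  ⟨[2, 2, 11], exists_isSTPP_222sq_seed_2_2_11⟩, ⟨[3, 3, 5], exists_isSTPP_222sq_seed_3_3_5⟩,
  ⟨[7, 7], exists_isSTPP_222sq_seed_7_7⟩, ⟨[2, 5, 5], exists_isSTPP_222sq_seed_2_5_5⟩,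
  ⟨[3, 3, 7], exists_isSTPP_222sq_seed_3_3_7⟩, ⟨[3, 5, 5], exists_isSTPP_222sq_seed_3_5_5⟩,
  ⟨[11, 11], exists_isSTPP_222sq_seed_11_11⟩, ⟨[5, 5, 5], exists_isSTPP_222sq_seed_5_5_5⟩,
  ⟨[13, 13], exists_isSTPP_222sq_seed_13_13⟩, ⟨[17, 17], exists_isSTPP_222sq_seed_17_17⟩,
  ⟨[19, 19], exists_isSTPP_222sq_seed_19_19⟩, ⟨[23, 23], exists_isSTPP_222sq_seed_23_23⟩]

/-- The 13 prime powers `≤ 23`. -/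
def ppList23 : List ℕ := [2, 4, 8, 16, 3, 9, 5, 7, 11, 13, 17, 19, 23]

/-- The cap for a prime power `v ≤ 23`: the least `c` with `v ^ c ≥ 26` (so capping keeps products `≥ 26`,
in particular never produces the excluded order `25`). -/
def cap26 (v : ℕ) : ℕ := if v = 2 then 5 else if v ≤ 5 then 3 else 2

/-- For a modulus `E`, the prime powers `≤ 23` dividing `E`, each paired with its cap. -/
def capList26 (E : ℕ) : List (ℕ × ℕ) := (ppList23.filter (· ∣ E)).map fun v => (v, cap26 v)

/-- COMBINATORIAL CORE (kernel decision): for every modulus `1 ≤ E ≤ 23`, every sub-multiset of the capping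
multiset `C_E` with product `≥ 24` and `≠ 25` dominates one of the 28 seeds. -/
theorem dom_of_capped24 : ∀ E ∈ List.range' 1 23, ∀ M ∈ subMS (capList26 E), 24 ≤ M.prod → M.prod ≠ 25 →
    ∃ sd ∈ seeds2, dom sd.s M = true := by
  decide +kernel

/-- The caps are large enough: `v ^ (multiplicity of v in C_E) ≥ 26` for every prime power `v ≤ 23` dividing `E`,
`1 ≤ E ≤ 23` (kernel decision). -/
theorem cap26_spec : ∀ E ∈ List.range' 1 23, ∀ v ∈ ppList23, v ∣ E →
    26 ≤ v ^ Multiset.count v (capMS (capList26 E)) := by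
  decide +kernel

/-- A prime power `p ^ k ≤ 23` with `k ≥ 1` is one of the 13 listed prime powers. -/
theorem pow_mem_ppList23 {p k : ℕ} (hp : p.Prime) (hk : 0 < k) (h : p ^ k ≤ 23) : p ^ k ∈ ppList23 := by
  have hp2 := hp.two_le
  have hp23 : p ≤ 23 := le_trans (Nat.le_self_pow hk.ne' p) h
  have hk4 : k ≤ 4 := by
    by_contra hk5
    have h32 : 2 ^ 5 ≤ p ^ k :=
      le_trans (Nat.pow_le_pow_right (by norm_num) (by omega)) (Nat.pow_le_pow_left hp2 k)
    omega
  interval_cases p <;> interval_cases k <;>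
    first | decide | (exfalso; revert hp; norm_num; done) | (exfalso; revert h; norm_num)

/-- Elements of `ppList23` are positive. -/
theorem one_le_of_mem_ppList23 {a : ℕ} (h : a ∈ ppList23) : 1 ≤ a := by
  simp only [ppList23, List.mem_cons, List.mem_nil_iff, or_false] at h
  omega

/-! ## 2. The capping step -/

/-- If every element `a` of `M` satisfies `N ≤ a ^ count a C` and `1 ≤ a`, and `N ≤ M.prod`, then the capped
multiset `M ∩ C` still has product `≥ N` (`prod_inter_ge` of `STPP222CubeFrom46.lean` with the threshold as a
parameter). -/
theorem prod_inter_ge_of {N : ℕ} {M C : Multiset ℕ} (hM : N ≤ M.prod) (hpos : ∀ a ∈ M, 1 ≤ a)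
    (hcap : ∀ a ∈ M, N ≤ a ^ Multiset.count a C) : N ≤ (M ∩ C).prod := by
  by_cases hle : M ≤ C
  · have : M ∩ C = M := le_antisymm Multiset.inter_le_left (Multiset.le_inter le_rfl hle)
    rw [this]; exact hM
  · rw [Multiset.le_iff_count] at hle
    push Not at hle
    obtain ⟨a, ha⟩ := hle
    have haM : a ∈ M := Multiset.count_pos.1 (by omega)
    have hcnt : Multiset.count a (M ∩ C) = Multiset.count a C := by
      rw [Multiset.count_inter]; omega
    have hrep : Multiset.replicate (Multiset.count a C) a ≤ M ∩ C :=
      Multiset.le_count_iff_replicate_le.1 hcnt.ge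
    obtain ⟨R, hR⟩ := Multiset.le_iff_exists_add.1 hrep
    have hRpos : ∀ x ∈ R, 1 ≤ x := fun x hx =>
      hpos x (Multiset.mem_of_le Multiset.inter_le_left (hR ▸ Multiset.mem_add.2 (Or.inr hx)))
    have h1 : 1 ≤ R.prod := Multiset.one_le_prod_of_one_le hRpos
    rw [hR, Multiset.prod_add, Multiset.prod_replicate]
    calc N ≤ a ^ Multiset.count a C := hcap a haM
      _ = a ^ Multiset.count a C * 1 := (mul_one _).symm
      _ ≤ a ^ Multiset.count a C * R.prod := Nat.mul_le_mul_left _ h1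

/-- **Domination for an arbitrary multiset**: a multiset of prime powers from `ppList23`, all dividing some
`1 ≤ E ≤ 23`, with product `≥ 24` and `≠ 25`, dominates one of the 28 seeds. -/
theorem exists_seed2_dom {M : Multiset ℕ} {E : ℕ} (hE1 : 1 ≤ E) (hE23 : E ≤ 23)
    (hpp : ∀ a ∈ M, a ∈ ppList23) (hdvd : ∀ a ∈ M, a ∣ E) (h24 : 24 ≤ M.prod) (h25 : M.prod ≠ 25) :
    ∃ sd ∈ seeds2, dom sd.s M = true := by
  have hEI : E ∈ List.range' 1 23 := List.mem_range'_1.2 ⟨hE1, by omega⟩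
  set C := capMS (capList26 E) with hC
  have hpos : ∀ a ∈ M, 1 ≤ a := fun a ha => one_le_of_mem_ppList23 (hpp a ha)
  have hcap26 : ∀ a ∈ M, 26 ≤ a ^ Multiset.count a C := fun a ha => cap26_spec E hEI a (hpp a ha) (hdvd a ha)
  have hmem : M ∩ C ∈ subMS (capList26 E) := mem_subMS_of_le _ _ Multiset.inter_le_right
  have hge : 24 ≤ (M ∩ C).prod ∧ (M ∩ C).prod ≠ 25 := by
    by_cases h26 : 26 ≤ M.prod
    · have := prod_inter_ge_of (C := C) h26 hpos hcap26
      exact ⟨by omega, by omega⟩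
    · have h24' : 24 ≤ (M ∩ C).prod :=
        prod_inter_ge_of (C := C) h24 hpos (fun a ha => le_trans (by norm_num) (hcap26 a ha))
      have hdv : (M ∩ C).prod ∣ M.prod := Multiset.prod_dvd_prod_of_le Multiset.inter_le_left
      have hle : (M ∩ C).prod ≤ M.prod := Nat.le_of_dvd (by omega) hdv
      exact ⟨h24', by omega⟩
  obtain ⟨sd, hsd, hD⟩ := dom_of_capped24 E hEI (M ∩ C) hmem hge.1 hge.2
  exact ⟨sd, hsd, dom_mono sd.s Multiset.inter_le_left hD⟩

/-! ## 3. Assembly -/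

/-- Transport of the `(2,2,2)²` statement along an injective additive hom (`IsSTPP.image` + injectivity of
`Finset.image`). [cite: CohnKleinbergSzegedyUmans2005, Def. 5.1] -/
theorem exists_isSTPP_222sq_of_injective {H K : Type*} [AddCommGroup H] [AddCommGroup K]
    (φ : H →+ K) (hφ : Function.Injective φ)
    (h : ∃ A B C : Fin 2 → Finset H, IsSTPP A B C ∧
      ∀ i, (A i).card = 2 ∧ (B i).card = 2 ∧ (C i).card = 2) :
    ∃ A B C : Fin 2 → Finset K, IsSTPP A B C ∧ ∀ i, (A i).card = 2 ∧ (B i).card = 2 ∧ (C i).card = 2 := by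
  classical
  obtain ⟨A, B, C, hS, hc⟩ := h
  refine ⟨fun i => (A i).image φ, fun i => (B i).image φ, fun i => (C i).image φ, hS.image φ hφ,
    fun i => ?_⟩
  obtain ⟨hA, hB, hC⟩ := hc i
  exact ⟨by rw [card_image_of_injective _ hφ, hA], by rw [card_image_of_injective _ hφ, hB],
    by rw [card_image_of_injective _ hφ, hC]⟩

/-- **The product case.** `Π i, ℤ/(pᵢ^{eᵢ})` (primes `pᵢ`, finitely many `i`) admits `(2,2,2)²` as soon as every
`pᵢ^{eᵢ}` divides some `1 ≤ E ≤ 23`, `∏ pᵢ^{eᵢ} ≥ 24` and `∏ pᵢ^{eᵢ} ≠ 25`: the multiset of nontrivial factors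
dominates a seed (`exists_seed2_dom`), the seed group embeds (`exists_emb_of_dom`), and the seed's kernel witness is
transported. [cite: CohnKleinbergSzegedyUmans2005, Def. 5.1] -/
theorem exists_isSTPP_222sq_pi {ι : Type} [Fintype ι] [DecidableEq ι] (p e : ι → ℕ)
    (hp : ∀ i, (p i).Prime) {E : ℕ} (hE1 : 1 ≤ E) (hE23 : E ≤ 23) (hdvd : ∀ i, p i ^ e i ∣ E)
    (hcard : 24 ≤ ∏ i, p i ^ e i) (h25 : ∏ i, p i ^ e i ≠ 25) :
    ∃ A B C : Fin 2 → Finset (Π i, ZMod (p i ^ e i)), IsSTPP A B C ∧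
      ∀ i, (A i).card = 2 ∧ (B i).card = 2 ∧ (C i).card = 2 := by
  have hq0 : ∀ i, p i ^ e i ≠ 0 := fun i => pow_ne_zero _ (hp i).ne_zero
  have hprodeq : ((Finset.univ.filter fun i => 0 < e i).val.map fun i => p i ^ e i).prod = ∏ i, p i ^ e i := by
    rw [← Finset.prod_eq_multiset_prod]
    exact Finset.prod_filter_of_ne fun i _ hi => Nat.pos_of_ne_zero fun h0 => hi (by rw [h0, pow_zero])
  have hprod : 24 ≤ ((Finset.univ.filter fun i => 0 < e i).val.map fun i => p i ^ e i).prod := by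
    rw [hprodeq]; exact hcard
  have hprod25 : ((Finset.univ.filter fun i => 0 < e i).val.map fun i => p i ^ e i).prod ≠ 25 := by
    rw [hprodeq]; exact h25
  have hmem : ∀ a ∈ ((Finset.univ.filter fun i => 0 < e i).val.map fun i => p i ^ e i),
      a ∈ ppList23 ∧ a ∣ E := by
    intro a ha
    obtain ⟨i, hi, rfl⟩ := Multiset.mem_map.1 ha
    have hi' : 0 < e i := (Finset.mem_filter.1 hi).2
    exact ⟨pow_mem_ppList23 (hp i) hi' (le_trans (Nat.le_of_dvd (by omega) (hdvd i)) hE23), hdvd i⟩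
  obtain ⟨sd, -, hD⟩ :=
    exists_seed2_dom hE1 hE23 (fun a ha => (hmem a ha).1) (fun a ha => (hmem a ha).2) hprod hprod25
  obtain ⟨φ, hφ, -⟩ := exists_emb_of_dom (fun i => p i ^ e i) hq0 sd.s _ hD
  exact exists_isSTPP_222sq_of_injective φ hφ sd.ok

/-- **Every finite abelian group of order `≥ 24` and `≠ 25` admits two simultaneous-TPP triples of 2-subsets**
(CKSU 2005 Def. 5.1, tree form `IsSTPP`; the pattern `(2,2,2)²`).  Exponent `≥ 24`: the cyclic family of
`STPP222PowCyclic.lean` (`exists_isSTPP_222pow_of_exponent 2`).  Exponent `≤ 23`: structure theorem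
`AddCommGroup.equiv_directSum_zmod_of_finite` + `exists_isSTPP_222sq_pi` + transport.  The excluded order `25` is
exactly `ℤ/5 × ℤ/5` (no `(2,2,2)²`, engine fact) and `ℤ/25` (`exists_isSTPP_222sq_zmod25`).  No `ω` bound follows.
[cite: CohnKleinbergSzegedyUmans2005, Def. 5.1] -/
theorem exists_isSTPP_222sq_of_card_ne {G : Type*} [AddCommGroup G] [Finite G] (hG : 24 ≤ Nat.card G)
    (h25 : Nat.card G ≠ 25) :
    ∃ A B C : Fin 2 → Finset G, IsSTPP A B C ∧ ∀ i, (A i).card = 2 ∧ (B i).card = 2 ∧ (C i).card = 2 := by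
  classical
  by_cases hexp : 24 ≤ AddMonoid.exponent G
  · exact exists_isSTPP_222pow_of_exponent 2 (by norm_num; exact hexp)
  obtain ⟨ι, _, p, hp, e, ⟨g⟩⟩ := AddCommGroup.equiv_directSum_zmod_of_finite G
  let f : G ≃+ (Π i, ZMod (p i ^ e i)) :=
    g.trans (DirectSum.linearEquivFunOnFintype ℕ ι (fun i => ZMod (p i ^ e i))).toAddEquiv
  have hE1 : 1 ≤ AddMonoid.exponent G := Nat.pos_of_ne_zero AddMonoid.exponent_ne_zero_of_finite
  have hdvd : ∀ i, p i ^ e i ∣ AddMonoid.exponent G := fun i => by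
    have hinj : Function.Injective (AddMonoidHom.single (fun j => ZMod (p j ^ e j)) i) :=
      Pi.single_injective (M := fun j => ZMod (p j ^ e j)) i
    have h1 : addOrderOf (f.symm (AddMonoidHom.single (fun j => ZMod (p j ^ e j)) i 1)) = p i ^ e i := by
      rw [AddEquiv.addOrderOf_eq, addOrderOf_injective _ hinj, ZMod.addOrderOf_one]
    rw [← h1]
    exact AddMonoid.addOrder_dvd_exponent _
  have hcardeq : Nat.card G = ∏ i, p i ^ e i := by
    rw [Nat.card_congr f.toEquiv, Nat.card_pi]
    simp [Nat.card_zmod]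
  have h := exists_isSTPP_222sq_pi p e hp hE1 (by omega) hdvd (by rw [← hcardeq]; exact hG)
    (by rw [← hcardeq]; exact h25)
  exact exists_isSTPP_222sq_of_injective f.symm.toAddMonoidHom f.symm.injective h

/-- `ℤ/25` admits `(2,2,2)²` (the symbolic-`k` cyclic family of `STPP222PowCyclic.lean` at `k = 2`, `m = 25 ≥ 24`).
[cite: CohnKleinbergSzegedyUmans2005, Def. 5.1] -/
theorem exists_isSTPP_222sq_zmod25 :
    ∃ A B C : Fin 2 → Finset (ZMod 25), IsSTPP A B C ∧ ∀ i, (A i).card = 2 ∧ (B i).card = 2 ∧ (C i).card = 2 :=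
  exists_isSTPP_222pow_zmod 2 25 (by norm_num)

/-- **Every finite abelian group of order `≥ 26` admits `(2,2,2)²`** (so `N₂ ≤ 26`; census: `= 26`, the obstruction
at `25` being `ℤ/5 × ℤ/5`). [cite: CohnKleinbergSzegedyUmans2005, Def. 5.1] -/
theorem exists_isSTPP_222sq_of_card {G : Type*} [AddCommGroup G] [Finite G] (hG : 26 ≤ Nat.card G) :
    ∃ A B C : Fin 2 → Finset G, IsSTPP A B C ∧ ∀ i, (A i).card = 2 ∧ (B i).card = 2 ∧ (C i).card = 2 :=
  exists_isSTPP_222sq_of_card_ne (by omega) (by omega)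

/-- Census name of the law (STRUCTURE.md Q7, row `k = 2`): `STPP222SqFrom26`, i.e. `exists_isSTPP_222sq_of_card`.
[cite: CohnKleinbergSzegedyUmans2005, Def. 5.1] -/
theorem stpp222SqFrom26 {G : Type*} [AddCommGroup G] [Finite G] (hG : 26 ≤ Nat.card G) :
    ∃ A B C : Fin 2 → Finset G, IsSTPP A B C ∧ ∀ i, (A i).card = 2 ∧ (B i).card = 2 ∧ (C i).card = 2 :=
  exists_isSTPP_222sq_of_card hG

end Summit.MatrixMultiplication.OmegaCensus
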